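import Summits.Langlands.Langlands.Theses.FifteenLocusEisenstein

/-!
# `FifteenLocusEisenstein.SectorComplement` (stmt-Langlands-16058) — logical position (SUSPECT-EQUIVALENCE audit)

Crux-strategist unit `cstrat-stmt-Langlands-16058-q1` (2026-08-17). The payload witness
`Theorems.skinnerWilesDefectOne_sectorComplement_iff_of_target` (Theorems/SkinnerWilesDefectOneSectorComplement.lean:51)
concerns the HOMONYMOUS frame item of route SkinnerWilesDefectOne (`ReducibleOrdinaryModular → Langlands`,
stmt-Langlands-12923), a different statement. This file records the identical position for THIS route's frame
`SectorComplement : Prop := (Target-text) → _root_.Langlands` (Target = point-count modularity of every non-CM integral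
elliptic curve over every imaginary quadratic field, INLINED verbatim in the item since rev 1), kernel-checked:

* `fle_sectorComplement_iff`          : `SectorComplement ↔ (Target → Langlands)` (by `Iff.rfl`: the inlined text IS `Target`);
* `fle_sectorComplement_of_langlands` : `Langlands → SectorComplement`;
* `fle_target_of_cruxes`               : the five case cruxes give `Target` by pure logic (the body of `closes` minus its last
  step, = the documentary support item `TargetOfCruxes`);
* `fle_sectorComplement_iff_of_target`: under `Target`, `SectorComplement ↔ Langlands` (the suspect equivalence, verbatim);
* `fle_sectorComplement_iff_of_cruxes`: under the other five binders of `closes` — `IrreducibleFiveModular`,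
  `NonOrdinaryEisensteinModular`, `UnorientedOrdinaryModular`, `ReducibleOrdinaryModular`, `OrientedOrdinaryOfEngine` —
  `SectorComplement ↔ Langlands` (`→` is the route's sorry-free `closes`);
* `fle_not_sectorComplement_iff`      : `¬ SectorComplement ↔ Target ∧ ¬ Langlands`;
* `fle_sectorComplement_iff_not_or`   : truth table `SectorComplement ↔ ¬ Target ∨ Langlands`;
* `fle_orientedOrdinaryOfEngine_iff`  : the logic-grade sibling is BY `Iff.rfl` an implication out of the OPEN engine;
* `fle_cases_of_target` / `fle_target_iff_cases_of_engine` : each case crux is a literal sub-case of `Target`, and modulo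
  the engine `Target ↔` the conjunction of the four elliptic-curve case cruxes (the sector decomposition is exact).

`Langlands → Target` is deliberately absent: true in substance (direction (B) of the summit at `n = 2` applied to
`ρ_(E,ℓ)`, read through Hasse–Weil) but not formal in this file's cone — it needs `ρ_(E,ℓ)` as a `FramedGaloisRep` with
irreducibility (Serre, non-CM), de Rham-ness for Fontaine's pinned datum and the proved Euler-factor theorem
(`framedTateGaloisRep`, outside the route's import cone by the rev-3 cone repair). Verdict of the audit
(EQUIVALENCE-AUDIT_FifteenLocusEisenstein.md): equivalence-benign — no item of the route is proved; the conditioning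
siblings are open and refuter-vetted; the one logic-grade sibling (`OrientedOrdinaryOfEngine`) is a declared bookkeeping
corollary that consumes the OPEN engine `ReducibleOrdinaryModular` non-vacuously.
-/

set_option linter.dupNamespace false

namespace Summit.Langlands.Langlands.Cruxes.SectorComplement.EquivalenceAuditFLE

open Summit.Langlands.Langlands.Theses.FifteenLocusEisenstein

/-- The frame is literally `Target → Langlands` (the item inlines the Target text verbatim). [folklore] -/
theorem fle_sectorComplement_iff : SectorComplement ↔ (Target → _root_.Langlands) :=
  Iff.rfl

/-- The frame is implied by the summit (discard the sector hypothesis). [folklore] -/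
theorem fle_sectorComplement_of_langlands : _root_.Langlands → SectorComplement :=
  fun h _ ↦ h

/-- The five case cruxes give the Target by pure logic: fix `F, E, hcpt`; split on irreducibility of `E[5]`, then on
near-ordinarity of weight 2 at every `v ∣ 5` of some irreducible Tate frame, then on the Skinner–Wiles datum (the body of
the route's `closes` short of its last step; = support item `TargetOfCruxes`). [folklore] -/
theorem fle_target_of_cruxes (h1 : IrreducibleFiveModular) (h3 : NonOrdinaryEisensteinModular)
    (h2 : UnorientedOrdinaryModular) (hE : ReducibleOrdinaryModular) (h4 : OrientedOrdinaryOfEngine) : Target := by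
  intro F _ _ htc hdeg E hΔ hcm hcpt
  haveI h5 : Fact (Nat.Prime 5) := ⟨by norm_num⟩
  by_cases hirr : (E.baseChange F).HasIrreducibleModPGaloisRep 5
  · exact h1 F htc hdeg E hΔ hcm hirr hcpt
  · by_cases hA : (∃ ρ : Literature.NumberTheory.GaloisRepresentations.FramedGaloisRep F (PadicAlgCl 5) 2, (ρ.toGaloisRep.IsIrreducible ∧ ∀ᶠ w : IsDedekindDomain.HeightOneSpectrum (NumberField.RingOfIntegers F) in Filter.cofinite, ρ.IsUnramifiedAt w ∧ ρ.HasFrobCharpolyAt w (Polynomial.X ^ 2 - Polynomial.C ((Literature.NumberTheory.Automorphic.frobTraceAt E w : ℤ) : PadicAlgCl 5) * Polynomial.X + Polynomial.C ((w.residueCard : ℕ) : PadicAlgCl 5))) ∧ ∀ v : IsDedekindDomain.HeightOneSpectrum (NumberField.RingOfIntegers F), ((5 : ℕ) : NumberField.RingOfIntegers F) ∈ v.asIdeal → ∃ m : ℕ, 0 < m ∧ ρ.IsOrdinaryOfWeightAt 5 v 2 m)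
    · by_cases hB : (∃ (O : ValuationSubring (PadicAlgCl 5)) (ρ : Literature.NumberTheory.GaloisRepresentations.FramedGaloisRep F (PadicAlgCl 5) 2) (ρ₀ : Field.absoluteGaloisGroup F →* Matrix.GeneralLinearGroup (Fin 2) O), O = (Valued.v : Valuation (PadicAlgCl 5) NNReal).valuationSubring ∧ (ρ.toGaloisRep.IsIrreducible ∧ ∀ᶠ w : IsDedekindDomain.HeightOneSpectrum (NumberField.RingOfIntegers F) in Filter.cofinite, ρ.IsUnramifiedAt w ∧ ρ.HasFrobCharpolyAt w (Polynomial.X ^ 2 - Polynomial.C ((Literature.NumberTheory.Automorphic.frobTraceAt E w : ℤ) : PadicAlgCl 5) * Polynomial.X + Polynomial.C ((w.residueCard : ℕ) : PadicAlgCl 5))) ∧ ρ.HasUpperTriangularIntegralModel ρ₀ ∧ ∃ m : ℕ, 0 < m ∧ ∀ v : IsDedekindDomain.HeightOneSpectrum (NumberField.RingOfIntegers F), ((5 : ℕ) : NumberField.RingOfIntegers F) ∈ v.asIdeal → Literature.NumberTheory.GaloisRepresentations.IsPDistinguishedAt ρ₀ v ∧ ∃ Q : Matrix.GeneralLinearGroup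 (Fin 2) (PadicAlgCl 5), Valued.v (Q.val 0 0) ≤ Valued.v (Q.val 1 0) ∧ ∀ σ, (Q⁻¹ * ρ.toLocal v σ * Q).val 1 0 = 0 ∧ (σ ∈ Literature.NumberTheory.GaloisRepresentations.absInertia (v.adicCompletion F) → (Q⁻¹ * ρ.toLocal v σ * Q).val 1 1 ^ m = 1 ∧ (Q⁻¹ * ρ.toLocal v σ * Q).val 0 0 ^ m = algebraMap (Padic 5) (PadicAlgCl 5) (((Literature.NumberTheory.GaloisRepresentations.GaloisRep.cyclotomicCharacter (v.adicCompletion F) 5 σ).val : PadicInt 5) : Padic 5) ^ ((2 - 1) * m)))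
      · exact h4 hE F htc hdeg 5 (by norm_num) E hΔ hcm hB hcpt
      · exact h2 F htc hdeg 5 (by norm_num) E hΔ hcm hirr hA hB hcpt
    · exact h3 F htc hdeg 5 (by norm_num) E hΔ hcm hirr hA hcpt

/-- Under the route Target the frame IS the summit: the suspect equivalence, verbatim for this route. [folklore] -/
theorem fle_sectorComplement_iff_of_target (hX : Target) : SectorComplement ↔ _root_.Langlands :=
  ⟨fun hC ↦ hC hX, fun h _ ↦ h⟩

/-- Under the other five binders of the deciding theorem the frame is equivalent to the summit (`→` is the route's
sorry-free `closes`). So this item can close only together with the summit once the route's five case cruxes land.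
[folklore] -/
theorem fle_sectorComplement_iff_of_cruxes (h1 : IrreducibleFiveModular) (h3 : NonOrdinaryEisensteinModular)
    (h2 : UnorientedOrdinaryModular) (hE : ReducibleOrdinaryModular) (h4 : OrientedOrdinaryOfEngine) :
    SectorComplement ↔ _root_.Langlands :=
  ⟨fun hC ↦ closes h1 h3 h2 hE h4 hC, fun h _ ↦ h⟩

/-- The same equivalence through `Target` (independent of `closes`). [folklore] -/
theorem fle_sectorComplement_iff_of_cruxes' (h1 : IrreducibleFiveModular) (h3 : NonOrdinaryEisensteinModular)
    (h2 : UnorientedOrdinaryModular) (hE : ReducibleOrdinaryModular) (h4 : OrientedOrdinaryOfEngine) :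
    SectorComplement ↔ _root_.Langlands :=
  fle_sectorComplement_iff_of_target (fle_target_of_cruxes h1 h3 h2 hE h4)

/-- Exact content of a refutation of the frame: prove the (open) Target — modularity of every non-CM elliptic curve over
every imaginary quadratic field — AND disprove the formal summit. [folklore] -/
theorem fle_not_sectorComplement_iff : ¬ SectorComplement ↔ Target ∧ ¬ _root_.Langlands :=
  Classical.not_imp

/-- Any refutation of the frame is a disproof of the formal summit `_root_.Langlands`. [folklore] -/
theorem fle_not_langlands_of_not_sectorComplement : ¬ SectorComplement → ¬ _root_.Langlands :=
  fun h ↦ (fle_not_sectorComplement_iff.1 h).2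

/-- Truth table of the frame: provable only by proving the summit or refuting the Target (a non-modular non-CM elliptic
curve over an imaginary quadratic field); refutable only in the world "Target true, summit false". [folklore] -/
theorem fle_sectorComplement_iff_not_or : SectorComplement ↔ ¬ Target ∨ _root_.Langlands :=
  imp_iff_not_or

/-- The bookkeeping sibling consumes the engine: `OrientedOrdinaryOfEngine` is, by `Iff.rfl`, an implication whose
antecedent is the OPEN engine `ReducibleOrdinaryModular` (stmt-Langlands-12918) — its candidate proofs apply that
hypothesis at `k = 2`; nothing of the oriented case is asserted unconditionally. [folklore] -/
theorem fle_orientedOrdinaryOfEngine_iff :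
    OrientedOrdinaryOfEngine ↔ (ReducibleOrdinaryModular → ∀ (F : Type) [Field F] [NumberField F], NumberField.IsTotallyComplex F → Module.finrank ℚ F = 2 → ∀ (p : ℕ) [Fact p.Prime], p ≠ 2 → ∀ (E : WeierstrassCurve (NumberField.RingOfIntegers F)), E.Δ ≠ 0 → ¬ (E.baseChange F).HasCM → (∃ (O : ValuationSubring (PadicAlgCl p)) (ρ : Literature.NumberTheory.GaloisRepresentations.FramedGaloisRep F (PadicAlgCl p) 2) (ρ₀ : Field.absoluteGaloisGroup F →* Matrix.GeneralLinearGroup (Fin 2) O), O = (Valued.v : Valuation (PadicAlgCl p) NNReal).valuationSubring ∧ (ρ.toGaloisRep.IsIrreducible ∧ ∀ᶠ w : IsDedekindDomain.HeightOneSpectrum (NumberField.RingOfIntegers F) in Filter.cofinite, ρ.IsUnramifiedAt w ∧ ρ.HasFrobCharpolyAt w (Polynomial.X ^ 2 - Polynomial.C ((Literature.NumberTheory.Automorphic.frobTraceAt E w : ℤ) : PadicAlgCl p) * Polynomial.X + Polynomial.C ((w.residueCard : ℕ) : PadicAlgCl p))) ∧ ρ.HasUpperTriangularIntegralModel ρ₀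 ∧ ∃ m : ℕ, 0 < m ∧ ∀ v : IsDedekindDomain.HeightOneSpectrum (NumberField.RingOfIntegers F), (p : NumberField.RingOfIntegers F) ∈ v.asIdeal → Literature.NumberTheory.GaloisRepresentations.IsPDistinguishedAt ρ₀ v ∧ ∃ Q : Matrix.GeneralLinearGroup (Fin 2) (PadicAlgCl p), Valued.v (Q.val 0 0) ≤ Valued.v (Q.val 1 0) ∧ ∀ σ, (Q⁻¹ * ρ.toLocal v σ * Q).val 1 0 = 0 ∧ (σ ∈ Literature.NumberTheory.GaloisRepresentations.absInertia (v.adicCompletion F) → (Q⁻¹ * ρ.toLocal v σ * Q).val 1 1 ^ m = 1 ∧ (Q⁻¹ * ρ.toLocal v σ * Q).val 0 0 ^ m = algebraMap (Padic p) (PadicAlgCl p) (((Literature.NumberTheory.GaloisRepresentations.GaloisRep.cyclotomicCharacter (v.adicCompletion F) p σ).val : PadicInt p) : Padic p) ^ ((2 - 1) * m))) → ∀ (hcpt : Literature.NumberTheory.Automorphic.isCompact_glFiniteIntegralLevel 2 F), ∃ π : Literature.NumberTheory.Automorphic.CuspidalAutomorphicRepData 2 F hcpt, π.1.IsLAlgebraic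 ∧ ∀ᶠ w : IsDedekindDomain.HeightOneSpectrum (NumberField.RingOfIntegers F) in Filter.cofinite, ∃ α : Multiset ℂ, π.1.HasSatakeParamAt w α ∧ (α.map fun a => a⁻¹).sum = (Literature.NumberTheory.Automorphic.frobTraceAt E w : ℂ) ∧ (α.map fun a => a⁻¹).prod = (w.residueCard : ℂ)) :=
  Iff.rfl

/-- Each case crux is a literal SUB-CASE of the Target (pure logic: drop the mechanism hypotheses) — so none of them is
refutable short of a non-modular non-CM elliptic curve over an imaginary quadratic field, and the Target is an upper bound
of their joint content. [folklore] -/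
theorem fle_cases_of_target (hT : Target) :
    IrreducibleFiveModular ∧ NonOrdinaryEisensteinModular ∧ UnorientedOrdinaryModular ∧
      (ReducibleOrdinaryModular → OrientedOrdinaryOfEngine) := by
  refine ⟨?_, ?_, ?_, ?_⟩
  · intro F _ _ htc hdeg E hΔ hcm _ hcpt
    exact hT F htc hdeg E hΔ hcm hcpt
  · intro F _ _ htc hdeg p _ _ E hΔ hcm _ _ hcpt
    exact hT F htc hdeg E hΔ hcm hcpt
  · intro F _ _ htc hdeg p _ _ E hΔ hcm _ _ _ hcpt
    exact hT F htc hdeg E hΔ hcm hcpt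
  · intro _ _ F _ _ htc hdeg p _ _ E hΔ hcm _ hcpt
    exact hT F htc hdeg E hΔ hcm hcpt

/-- Consequently, modulo the engine, the Target is EQUIVALENT to the conjunction of the four elliptic-curve case cruxes
(the route's sector decomposition is exact, not lossy): `ReducibleOrdinaryModular → (Target ↔ I5 ∧ N ∧ U ∧ O)`. [folklore] -/
theorem fle_target_iff_cases_of_engine (hE : ReducibleOrdinaryModular) :
    Target ↔ IrreducibleFiveModular ∧ NonOrdinaryEisensteinModular ∧ UnorientedOrdinaryModular ∧
      OrientedOrdinaryOfEngine :=
  ⟨fun hT ↦ let ⟨h1, h3, h2, h4⟩ := fle_cases_of_target hT; ⟨h1, h3, h2, h4 hE⟩,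
    fun ⟨h1, h3, h2, h4⟩ ↦ fle_target_of_cruxes h1 h3 h2 hE h4⟩

end Summit.Langlands.Langlands.Cruxes.SectorComplement.EquivalenceAuditFLE
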